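import Summits.MatrixMultiplication.OmegaCensus.SmallFormats.MatMul22nRankGF7Slack4Search
import HarnessLib

/-!
# ω-census family (a): slack-4 bucket-completeness check (CHECK A) over the slots of classes 20–39 (part 2 of 6)

Cell `pub-omega` (unit `pub-omega-tensor-g15`), topic `Summits/MatrixMultiplication/OmegaCensus` (sub-folder `SmallFormats`).
Framing (verbatim): lottery ticket; floor = certified bounds/negative ranges. HONEST FRAMING: kernel replays of the slack-4 search certificate
(`MatMul22nRankGF7Slack4Search`; generated by `pub-omega-tensor-g15/code/gen_runfiles.py`); meaning only through
`MatMul22nRankGF7Slack4SearchSound2.search7_sound`. Nothing here is progress on `ω`.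
-/

namespace Summit.MatrixMultiplication.OmegaCensus.SmallFormats

set_option maxRecDepth 100000 in
set_option maxHeartbeats 40000000 in
/-- `slotOK7 c h` for `20 ≤ c < 25`, all `h < 336`. -/
theorem slotOK7_ok_2_1 : ∀ c : Fin 120, 20 ≤ c.val → c.val < 25 → ∀ h : Fin 336, slotOK7 c.val h.val = true := by decide +kernel

set_option maxRecDepth 100000 in
set_option maxHeartbeats 40000000 in
/-- `slotOK7 c h` for `25 ≤ c < 30`, all `h < 336`. -/
theorem slotOK7_ok_2_2 : ∀ c : Fin 120, 25 ≤ c.val → c.val < 30 → ∀ h : Fin 336, slotOK7 c.val h.val = true := by decide +kernel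

set_option maxRecDepth 100000 in
set_option maxHeartbeats 40000000 in
/-- `slotOK7 c h` for `30 ≤ c < 35`, all `h < 336`. -/
theorem slotOK7_ok_2_3 : ∀ c : Fin 120, 30 ≤ c.val → c.val < 35 → ∀ h : Fin 336, slotOK7 c.val h.val = true := by decide +kernel

set_option maxRecDepth 100000 in
set_option maxHeartbeats 40000000 in
/-- `slotOK7 c h` for `35 ≤ c < 40`, all `h < 336`. -/
theorem slotOK7_ok_2_4 : ∀ c : Fin 120, 35 ≤ c.val → c.val < 40 → ∀ h : Fin 336, slotOK7 c.val h.val = true := by decide +kernel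

/-- `slotOK7 c h` for `20 ≤ c < 40`, `h < 336`. -/
theorem slotOK7_ok_2 {c : ℕ} (h1 : 20 ≤ c) (h2 : c < 40) {h : ℕ} (hh : h < 336) : slotOK7 c h = true := by
  by_cases hb1 : c < 25
  · exact slotOK7_ok_2_1 ⟨c, by omega⟩ (by show 20 ≤ c; omega) hb1 ⟨h, hh⟩
  by_cases hb2 : c < 30
  · exact slotOK7_ok_2_2 ⟨c, by omega⟩ (by show 25 ≤ c; omega) hb2 ⟨h, hh⟩
  by_cases hb3 : c < 35
  · exact slotOK7_ok_2_3 ⟨c, by omega⟩ (by show 30 ≤ c; omega) hb3 ⟨h, hh⟩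
  exact slotOK7_ok_2_4 ⟨c, by omega⟩ (by show 35 ≤ c; omega) (by show c < 40; omega) ⟨h, hh⟩

end Summit.MatrixMultiplication.OmegaCensus.SmallFormats
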